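/-
Copyright: the b2b-balaban cell (near-miss cell 7), T⁴-continuum fan-out; row NE7b ROUND-2 swarm, seat
t4-ne7b-formalise-leaf-10 (gen 6) — supplier piece «T3b-READ» for the S6g′ INSTANCE's T3b (owner's rulings
R-OWNER-22-23, R-OWNER-23-3∕-4∕-5∕-7; T3b holder leaf-05 g4), part 3 of 3: CHAINS OF JOINS AND PEDIGREES — the part
sub-members ARE the listed parts (journal OFFER l.13598, booking l.13733, split R-OWNER-23-7 l.13900).  A supplier
module consumed BY NAME; not a claim of T3b.  Released under the licence of the surrounding project.
-/
import Summits.QuantumFields.BalabanUV.T4Continuum.Support.HistoryMemberPlacementRead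
import Summits.QuantumFields.BalabanUV.T4Continuum.Support.HistoryGenAdm

/-!
# The member's placement reading, part 3: chains of joins, and the sorted twin's member on the counted tree

Summits-side support leaf of the T⁴-continuum cell (rung (B)+1 on a FINITE torus only; NOT infinite volume, NOT the
mass gap, NOT the Clay statement; NOT a proof of the spine estimate NE7b).  Row NE7b, route «COUNT», row S6g′
INSTANCE, piece T3b (holder leaf-05 g4) — the member side, continued from parts 1–2 (`HistoryMemberPlacement`:
`placed`, `subAt`, `cfg_placed_join`; `HistoryMemberPlacementRead`: `evalA_placed_rootAddr`, `bread_placed`) with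
leaf-09's bridge (`chainJoin`, `Pedigree.toPGen`, `partPGen`, `HistoryGenAdm.lastStep_toPGen_le`) and leaf-10 gen 3∕5's
sorted twin (`Pedigree.sortR`, `toGen_toPGen_sortR`, `pbirths∕rootCell_toPGen_sortR`, `toPGen_sortR_of_cons`,
`renewDated_sortR`).  [folklore] structural recursion and list bookkeeping; nothing is quoted from print, nothing printed
is asserted, no `[cite:]` tag, no definition.

WHAT.
* §4a `bread_cfg_placed_ne_of_nodup`: part 2's `bread_cfg_placed_ne` at `w := id` — `hdis` on the value multiset itself ⇒
  distinct parts of a join's top join read different births (the clause-2 input of `PhysTop`, verbatim).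
* §4b the parts of a CHAIN of joins read as sub-members: `exists_chainJoin_eq_join`, `clusterParts_toGen_of_ne_join`
  (a member that is not a step-`s` join is ONE step-`s` part), `ne_join_of_lastStep_lt`, `map_subAt_clusterParts_chainJoin`,
  **`map_subAt_jparts_chainJoin`** (the part sub-members of `chainJoin A Bs s` over closed members are `A :: Bs`, in
  order), `npart_chainJoin`, **`subAt_part_chainJoin`** (leaf-05 g2's `i`-th `part` reads the `i`-th listed member).
* §5 on pedigrees: under `RenewDated` (`RealisedDomainsR.renew_step`) **`junk_placed_sortR`**; with `HeadOldest`
  (`RealisedDomainsR.headOldest`) **`bread_placed_sortR`**, **`evalA_placed_sortR_rootAddr`** — the sorted twin's member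
  `P.sortR.toPGen cell c`, placed on the counted tree `P.sortR.gen c`, is junk, reads the REALISED member's physical
  births `(P.toPGen cell c).pbirths` through `v`, and has root value `v (root label) (P.toPGen cell c).rootCell`; and
  the identification of the top join's parts with the listing: `partPGen_ne_join_step` (a listed part's `PGen` is never
  a join at the component's own step), **`map_subAt_jparts_toPGen`** ∕ **`map_subAt_jparts_toPGen_sortR`** (for a
  component with ≥ 2 parts, the part sub-members of its member, in the order of leaf-05 g2's `jparts`, ARE the listed
  parts' `partPGen`s — for the sorted twin, the ρ-sorted listing's), `npart_gen_sortR`, **`subAt_part_gen_sortR`**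
  (indexed form on the COUNTED tree `P.sortR.gen c`: the `i`-th `part` reads the `i`-th listed part's `PGen` — the
  junction with leaf-10 gen 5's `partPGen_sortR_agree` for T3b-3's contact transport).
* §6 sanity (an m1 join of a renewed birth: addresses, junk, order-blindness of the physical reading).

HONEST SCOPE.  As parts 1–2: the member side only; `PhysTop` clause 1 from `Realises`, `hzone`, `hρ`, the template
factor and the image count into `koccOf` are T3b's.  Nothing of H3∕(B)∕BetaPertH touched; `BirthShapeNodup`∕`resum`∕
`hmult`∕`hdis` NOT retired; NE7b NOT proved; spine 0∕9.  HONEST DEPENDENCY (cell): continuum YM on T⁴ ⇐ BetaPertH ∧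
nine spine estimates (0/9 proved); BetaPertH ⇐ (D1) ∧ (D4) ∧ CAP+tail; G-an2-4 gates asym, D1 and NE2/3/4.  This
file changes none of it.
-/

open Finset
open Literature.MathematicalPhysics.QuantumFieldTheory.Balaban1983to89
open T4PersistenceDictionary
open Summit.QuantumFields.BalabanUV.T4Continuum.HistoryGen
open Summit.QuantumFields.BalabanUV.T4Continuum.HistoryJoins
open Summit.QuantumFields.BalabanUV.T4Continuum.HistoryJoinsAdm
open Summit.QuantumFields.BalabanUV.T4Continuum.HistoryJoinsRearrange

noncomputable section

namespace Summit.QuantumFields.BalabanUV.T4Continuum.HistoryAdmissible.PGen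

variable {γ ν : Type*} {D : ℕ} (c₀ : ν) (v : PEv → γ → ν)

/-! ## §4a The duplicate-free clause in the letters of the key of record (no extra reading map) -/

/-- **`hdis` ⇒ DISTINCT PARTS READ DIFFERENT BIRTHS**, stated for the value multiset itself (`w := id` in part 2's
`bread_cfg_placed_ne`): the `hd`∕clause-2 input of `PhysTop` for the member's placement, in the letters of
R-OWNER-23-6's displayed side condition. [folklore] -/
theorem bread_cfg_placed_ne_of_nodup (X Y : PGen γ) (s : ℕ) (hD : ∀ b ∈ baddr (join X Y s).toGen, b.length ≤ D)
    (hdis : ((join X Y s).pbirths.map fun bz => (bz.1, v bz.1 bz.2)).Nodup)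
    {i j : Fin (npart PEv.step (Gen.merge X.toGen Y.toGen ((s, 2, 0) : PEv)))} (hij : i ≠ j) :
    bread c₀ (part PEv.step _ i).2 (cfg c₀ PEv.step X.toGen Y.toGen ((s, 2, 0) : PEv) (placed (D := D) c₀ v (join X Y s)) i) ≠
      bread c₀ (part PEv.step _ j).2 (cfg c₀ PEv.step X.toGen Y.toGen ((s, 2, 0) : PEv) (placed (D := D) c₀ v (join X Y s)) j) := by
  have h := bread_cfg_placed_ne c₀ v id X Y s hD (by rwa [Multiset.map_id]) hij
  rwa [Multiset.map_id, Multiset.map_id] at h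

/-! ## §4b The parts of a chain of joins, read as sub-members -/

/-- a non-trivial chain of joins is a join at the chain's step [folklore] -/
theorem exists_chainJoin_eq_join (s : ℕ) : ∀ (A : PGen γ) (Bs : List (PGen γ)), Bs ≠ [] →
    ∃ C B, chainJoin A Bs s = join C B s
  | _, [], h => absurd rfl h
  | A, [B], _ => ⟨A, B, rfl⟩
  | A, B :: B' :: Bs, _ => by
      rw [chainJoin]
      exact exists_chainJoin_eq_join s (join A B s) (B' :: Bs) (List.cons_ne_nil _ _)

/-- **A MEMBER THAT IS NOT A STEP-`s` JOIN IS ONE STEP-`s` CLUSTER PART** of its own flat tree (births, renewals and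
joins of another step are never dissolved). [folklore] -/
theorem clusterParts_toGen_of_ne_join {s : ℕ} : ∀ {M : PGen γ}, (∀ X Y, M ≠ join X Y s) →
    clusterParts PEv.step s M.toGen = [([], M.toGen)]
  | birth j d z, _ => by simp [toGen]
  | renew G h, _ => by simp [toGen]
  | join X Y s', hM => by
      have hs : PEv.step ((s', 2, 0) : PEv) ≠ s := fun h => hM X Y (by cases h; rfl)
      simp only [toGen]
      exact clusterParts_merge_of_ne PEv.step hs

/-- a member whose last step is before `s` is not a step-`s` join [folklore] -/
theorem ne_join_of_lastStep_lt {s : ℕ} {M : PGen γ} (h : M.lastStep < s) (X Y : PGen γ) : M ≠ join X Y s := by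
  rintro rfl; exact lt_irrefl _ h

/-- **THE STEP-`s` CLUSTER PARTS OF A CHAIN OF JOINS, READ AS SUB-MEMBERS**: the head's parts followed by each tail
member's parts, in the listing order. [folklore] -/
theorem map_subAt_clusterParts_chainJoin (s : ℕ) : ∀ (A : PGen γ) (Bs : List (PGen γ)),
    (clusterParts PEv.step s (chainJoin A Bs s).toGen).map (fun q => subAt (chainJoin A Bs s) q.1) =
      (clusterParts PEv.step s A.toGen).map (fun q => subAt A q.1) ++
        Bs.flatMap (fun B => (clusterParts PEv.step s B.toGen).map (fun q => subAt B q.1))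
  | A, [] => by simp [chainJoin]
  | A, B :: Bs => by
      rw [chainJoin, map_subAt_clusterParts_chainJoin s (join A B s) Bs, List.flatMap_cons, ← List.append_assoc]
      congr 1
      have hst : PEv.step ((s, 2, 0) : PEv) = s := rfl
      simp only [toGen]
      rw [clusterParts_merge_of_eq PEv.step hst, List.map_append, List.map_map, List.map_map]
      rfl

/-- **THE PARTS OF THE TOP JOIN OF A CHAIN OF CLOSED MEMBERS ARE THE MEMBERS, IN ORDER** (closed = not itself a
step-`s` join: the listing's births, renewals and earlier joins). [folklore] -/
theorem map_subAt_jparts_chainJoin (s : ℕ) (A : PGen γ) (Bs : List (PGen γ)) (hBs : Bs ≠ [])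
    (hT : ∀ M ∈ A :: Bs, ∀ X Y, M ≠ join X Y s) :
    (jparts PEv.step (chainJoin A Bs s).toGen).map (fun q => subAt (chainJoin A Bs s) q.1) = A :: Bs := by
  obtain ⟨C, B, hCB⟩ := exists_chainJoin_eq_join s A Bs hBs
  have hj : jparts PEv.step (chainJoin A Bs s).toGen = clusterParts PEv.step s (chainJoin A Bs s).toGen := by
    rw [hCB]; rfl
  rw [hj, map_subAt_clusterParts_chainJoin s A Bs,
    clusterParts_toGen_of_ne_join (hT A List.mem_cons_self), List.map_singleton, subAt_nil, List.singleton_append]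
  congr 1
  have : ∀ Bs' : List (PGen γ), (∀ M ∈ Bs', ∀ X Y, M ≠ join X Y s) →
      Bs'.flatMap (fun B => (clusterParts PEv.step s B.toGen).map (fun q => subAt B q.1)) = Bs' := by
    intro Bs' h
    induction Bs' with
    | nil => rfl
    | cons B Bs' ih =>
        rw [List.flatMap_cons, ih fun M hM => h M (List.mem_cons_of_mem _ hM),
          clusterParts_toGen_of_ne_join (h B List.mem_cons_self), List.map_singleton, subAt_nil, List.singleton_append]
  exact this Bs fun M hM => hT M (List.mem_cons_of_mem _ hM)


/-- … so the top join of such a chain has one part per listed member [folklore] -/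
theorem npart_chainJoin (s : ℕ) (A : PGen γ) (Bs : List (PGen γ)) (hBs : Bs ≠ [])
    (hT : ∀ M ∈ A :: Bs, ∀ X Y, M ≠ join X Y s) :
    npart PEv.step (chainJoin A Bs s).toGen = (A :: Bs).length := by
  rw [← map_subAt_jparts_chainJoin s A Bs hBs hT, List.length_map]; rfl

/-- … and its `i`-th part sub-member (leaf-05 g2's `part`) is the `i`-th listed member [folklore] -/
theorem subAt_part_chainJoin (s : ℕ) (A : PGen γ) (Bs : List (PGen γ)) (hBs : Bs ≠ [])
    (hT : ∀ M ∈ A :: Bs, ∀ X Y, M ≠ join X Y s) (i : Fin (npart PEv.step (chainJoin A Bs s).toGen)) :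
    subAt (chainJoin A Bs s) (part PEv.step _ i).1 =
      (A :: Bs).get ⟨i.1, by rw [← npart_chainJoin s A Bs hBs hT]; exact i.2⟩ := by
  have h := map_subAt_jparts_chainJoin s A Bs hBs hT
  have hi : i.1 < ((jparts PEv.step (chainJoin A Bs s).toGen).map fun q => subAt (chainJoin A Bs s) q.1).length := by
    rw [List.length_map]; exact i.2
  have e1 : ((jparts PEv.step (chainJoin A Bs s).toGen).map fun q => subAt (chainJoin A Bs s) q.1)[i.1] =
      subAt (chainJoin A Bs s) (part PEv.step _ i).1 := by
    rw [List.getElem_map]; rfl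
  rw [← e1]
  simp only [h, List.get_eq_getElem]

end Summit.QuantumFields.BalabanUV.T4Continuum.HistoryAdmissible.PGen

/-! ## §5 On pedigrees: the sorted twin's member placed on the sorted twin's flat tree -/

namespace Summit.QuantumFields.BalabanUV.T4Continuum.HistoryGen.Pedigree

open Summit.QuantumFields.BalabanUV.T4Continuum.HistoryAdmissible

variable {α π γ ν : Type*} [Inhabited γ] (P : Pedigree α π) (cell : π → γ) {D : ℕ} (c₀ : ν) (v : PEv → γ → ν)

/-- **THE SORTED TWIN'S MEMBER, PLACED, IS A JUNK PLACEMENT OF THE SORTED TWIN'S FLAT TREE** (`RenewDated` =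
`RealisedDomainsR.renew_step`). [folklore] -/
theorem junk_placed_sortR (hS : P.RenewDated) (c : α) :
    Junk (P.sortR.gen c) c₀ (PGen.placed (D := D) c₀ v (P.sortR.toPGen cell c)) := by
  rw [← P.toGen_toPGen_sortR cell hS c]
  exact PGen.junk_placed c₀ v _

/-- **… READS THE REALISED MEMBER'S PHYSICAL BIRTHS THROUGH THE VALUE MAP** (`HeadOldest` = `RealisedDomainsR.headOldest`;
depth: the sorted twin's birth addresses fit the space) — the recommended `phys` of R-OWNER-23-5 (2). [folklore] -/
theorem bread_placed_sortR (hH : ∀ c, P.HeadOldest c) (hS : P.RenewDated) (c : α)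
    (hD : ∀ a ∈ baddr (P.sortR.gen c), a.length ≤ D) :
    bread c₀ (P.sortR.gen c) (PGen.placed (D := D) c₀ v (P.sortR.toPGen cell c)) =
      (P.toPGen cell c).pbirths.map (fun bz => (bz.1, v bz.1 bz.2)) := by
  rw [← P.pbirths_toPGen_sortR cell hH hS c]
  have hD' : ∀ a ∈ baddr (P.sortR.toPGen cell c).toGen, a.length ≤ D := by
    rw [P.toGen_toPGen_sortR cell hS c]; exact hD
  rw [← PGen.bread_placed c₀ v _ hD', P.toGen_toPGen_sortR cell hS c]

/-- **… AND HAS THE ROOT VALUE `v (root label) (root cell of the REALISED member)`.** [folklore] -/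
theorem evalA_placed_sortR_rootAddr (hH : ∀ c, P.HeadOldest c) (hS : P.RenewDated) (c : α)
    (hD : ∀ a ∈ baddr (P.sortR.gen c), a.length ≤ D) :
    evalA c₀ (PGen.placed (D := D) c₀ v (P.sortR.toPGen cell c)) (rootAddr (P.sortR.gen c)) =
      v (Gen.root (P.sortR.gen c)) (P.toPGen cell c).rootCell := by
  have hD' : ∀ a ∈ baddr (P.sortR.toPGen cell c).toGen, a.length ≤ D := by
    rw [P.toGen_toPGen_sortR cell hS c]; exact hD
  rw [← P.rootCell_toPGen_sortR cell hH hS c, ← P.toGen_toPGen_sortR cell hS c]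
  exact PGen.evalA_placed_rootAddr c₀ v _ hD'


/-- **A LISTED PART'S `PGen` IS NEVER A JOIN AT THE COMPONENT'S OWN STEP** (new parts are births, renewed parts are
renewals, and an old part's member has its last step at the part's earlier step — leaf-09's `lastStep_toPGen_le`).
[folklore] -/
theorem partPGen_ne_join_step (Q : Pedigree α π) (hS : Q.RenewDated) (c : α) {p : Part α π} (hp : p ∈ Q.parts c)
    (X Y : PGen γ) : Q.partPGen cell c (Q.toPGen cell) p ≠ PGen.join X Y (Q.step c) := by
  rcases p with ⟨c', _ | _⟩ | ⟨d, x⟩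
  · exact PGen.ne_join_of_lastStep_lt ((Q.lastStep_toPGen_le cell hS c').trans_lt (Q.step_lt c c' false hp)) X Y
  · simp [partPGen]
  · simp [partPGen]

/-- **THE PART SUB-MEMBERS OF A COMPONENT'S MEMBER ARE THE LISTED PARTS' `PGen`s, IN THE LISTING ORDER** (for a
component with at least two parts, i.e. whose member is a join at its step). [folklore] -/
theorem map_subAt_jparts_toPGen (Q : Pedigree α π) (hS : Q.RenewDated) {c : α} {p p' : Part α π}
    {ps : List (Part α π)} (h : Q.parts c = p :: p' :: ps) :
    (jparts PEv.step (Q.toPGen cell c).toGen).map (fun q => PGen.subAt (Q.toPGen cell c) q.1) =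
      (Q.parts c).map (Q.partPGen cell c (Q.toPGen cell)) := by
  rw [Q.toPGen_of_cons cell h, h]
  have hall : ∀ M ∈ (p :: p' :: ps).map (Q.partPGen cell c (Q.toPGen cell)), ∀ X Y,
      M ≠ PGen.join X Y (Q.step c) := by
    intro M hM X Y
    obtain ⟨q, hq, rfl⟩ := List.mem_map.1 hM
    exact Q.partPGen_ne_join_step cell hS c (by rw [h]; exact hq) X Y
  exact PGen.map_subAt_jparts_chainJoin (Q.step c) _ _ (List.cons_ne_nil _ _) hall

/-- … in particular for the SORTED twin (renewal dating transfers by `renewDated_sortR`): the part sub-members of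
`P.sortR.toPGen cell c` are the ρ-sorted listing's part `PGen`s. [folklore] -/
theorem map_subAt_jparts_toPGen_sortR (hS : P.RenewDated) {c : α} {p p' : Part α π} {ps : List (Part α π)}
    (h : P.sortR.parts c = p :: p' :: ps) :
    (jparts PEv.step (P.sortR.gen c)).map (fun q => PGen.subAt (P.sortR.toPGen cell c) q.1) =
      (P.sortR.parts c).map (P.sortR.partPGen cell c (P.sortR.toPGen cell)) := by
  rw [← P.toGen_toPGen_sortR cell hS c]
  exact map_subAt_jparts_toPGen cell P.sortR (HistorySiblingEntropyBridge.renewDated_sortR P hS) h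

/-- … so the sorted twin's flat tree has one top-join part per listed part [folklore] -/
theorem npart_gen_sortR (hS : P.RenewDated) {c : α} {p p' : Part α π} {ps : List (Part α π)}
    (h : P.sortR.parts c = p :: p' :: ps) : npart PEv.step (P.sortR.gen c) = (P.sortR.parts c).length := by
  have e := congrArg List.length (P.map_subAt_jparts_toPGen_sortR (fun _ => ()) hS h)
  simpa [npart] using e

/-- … and the `i`-th part sub-member of the sorted twin's member (leaf-05 g2's `part` of the COUNTED tree
`P.sortR.gen c`) is the `i`-th listed part's `PGen` [folklore] -/
theorem subAt_part_gen_sortR (hS : P.RenewDated) {c : α} {p p' : Part α π} {ps : List (Part α π)}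
    (h : P.sortR.parts c = p :: p' :: ps) (i : Fin (npart PEv.step (P.sortR.gen c))) :
    PGen.subAt (P.sortR.toPGen cell c) (part PEv.step (P.sortR.gen c) i).1 =
      P.sortR.partPGen cell c (P.sortR.toPGen cell)
        ((P.sortR.parts c).get ⟨i.1, by rw [← P.npart_gen_sortR hS h]; exact i.2⟩) := by
  have hm := P.map_subAt_jparts_toPGen_sortR cell hS h
  have e1 : ((jparts PEv.step (P.sortR.gen c)).map fun q => PGen.subAt (P.sortR.toPGen cell c) q.1)[i.1]'(by
        rw [List.length_map]; exact i.2) = PGen.subAt (P.sortR.toPGen cell c) (part PEv.step (P.sortR.gen c) i).1 := by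
    rw [List.getElem_map]; rfl
  rw [← e1]
  simp only [hm, List.getElem_map, List.get_eq_getElem]

end Summit.QuantumFields.BalabanUV.T4Continuum.HistoryGen.Pedigree

/-! ## §6 Sanity -/

namespace Summit.QuantumFields.BalabanUV.T4Continuum.HistoryMemberPlacement.Sanity

open Summit.QuantumFields.BalabanUV.T4Continuum.HistoryAdmissible

/-- an m1 join of a renewed birth with a new birth: the placement reads the two cells at `[false]`∕`[true]` through
`v`, junk at `[]`; swapping the partners swaps the addresses but NOT the births' reading -/
example (v : PEv → ℕ → ℕ) :
    PGen.readAt 0 v (PGen.join (PGen.renew (PGen.birth 1 2 7) 4) (PGen.birth 5 0 9) 5) [false] = v (1, 0, 2) 7 ∧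
    PGen.readAt 0 v (PGen.join (PGen.renew (PGen.birth 1 2 7) 4) (PGen.birth 5 0 9) 5) [true] = v (5, 0, 0) 9 ∧
    PGen.readAt 0 v (PGen.join (PGen.renew (PGen.birth 1 2 7) 4) (PGen.birth 5 0 9) 5) [] = 0 ∧
    (PGen.join (PGen.renew (PGen.birth 1 2 7) 4) (PGen.birth 5 0 9) 5).pbirths =
      (PGen.join (PGen.birth 5 0 9) (PGen.renew (PGen.birth 1 2 7) 4) 5).pbirths :=
  ⟨rfl, rfl, rfl, by simp [add_comm]⟩

end Summit.QuantumFields.BalabanUV.T4Continuum.HistoryMemberPlacement.Sanity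

end
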